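import Mathlib
import Summits.ResolutionOfSingularities.ResolutionOfSingularities.Theorems.WeightedInvariantLocalWeightedDropTOT2NearSettingOld

/-!
# `WeightedInvariant.LocalWeightedDrop`, TOT₂ line / line `directrix-cut`: (N2) AT APEX DIMENSION TWO — `e^S ≤ 2` PERSISTS AT `O`-NEAR POINTS
# (hypersurface form with marked letters, every characteristic, every dimension)

Crux item stmt-ResolutionOfSingularities-8899 `LocalWeightedDrop` (route `ResolutionOfSingularities/WeightedInvariant`), ENGINE skeleton v32, residuals
`stub_spaceNCRankDrop` / `stub_wildWideApexFourStartsWon` (res-L1-w43-strat-1's line `directrix-cut` v3.1, piece PL = `ApexPlaneExit` = apex dimension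
`e = 2`; design memo `L/res-L1-w43-stub-4/g5/S-E2-SURF.md`).  [OURS · L1 W4.3 · chain w43 · seat res-L1-w43-stub-4 gen 5; def-free; the TRIPLES
twin of res-L1-w43-stub-3's S-NEAR part 7 `TOT2Near.apexLineRel_of_near` (pairs, `e^S ≤ 1`), on the same bricks (`insertNth_inv_of_inv_cons_zero`,
`initEval_add_smul_eq_of_near`); MODEL: Cossart–Jannsen–Saito LNM 2270 Thm 2.10 (4) / Thm 3.23 (1) (`e_{x′} ≤ e_x`, `e^O_{x′} ≤ e^O_x` at near points),
hypersurface form.  Nothing here is a statement of any manuscript; AI-produced, gate-checked, weaker than expert review.]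

SETTING (as in S-NEAR parts 2/7).  `f ∈ k⟦x₀..x_n⟧`, the point move (all weights `1`) at the exceptional point `c` with live slot `i₀`,
`f(s(c + y)) = s^o · G`, successor `G′ = G|_{y_{i₀} = 0}`, NEAR = `o ≤ ord G′`; invariance vectors `u` of the degree-`o` form
(`∀ v, in_o f (v + u) = in_o f (v)`); marked letters `S` with `c_l = 0` on `S` (the old components pass through the new point), successor marked
letters `predAbove i₀ (succ l)`.
* `dep_of_inv_cons_zero_rel₂` — at a near point, if every THREE vectors of `Dir^S(in_o f)` are dependent, then every TWO `s`-free invariance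
  vectors `(0, z′)` of the successor's form vanishing on the new marked letters are dependent (lift both by `insertNth_inv_of_inv_cons_zero`;
  together with `c` — an invariance vector by (N1), vanishing on `S`, with `c_{i₀} ≠ 0` — they are three vectors of `Dir^S`, and the dependence
  cannot involve `c`).
* **`apexPlaneRel_of_near`** — (N2) AT `e ≤ 2` WITH MARKED LETTERS: if every three vectors of `Dir^S(in_o f)` are dependent, then at an
  `O`-near point every three invariance vectors of `in_o G′` vanishing on the successor's marked letters are dependent (`e^S ≤ 2` persists):
  eliminate the `s`-components against a pivot and apply the previous lemma.
* `apexPlane_of_near` — the unmarked form (`S = ∅`): the engine's binder `htwo` propagated to the successor of a near point move.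
-/

set_option linter.dupNamespace false -- mandated namespace of this single-conjunct summit
set_option autoImplicit false

noncomputable section

namespace Summit.ResolutionOfSingularities.ResolutionOfSingularities.Theorems

namespace TOT2Near

open MvPowerSeries Literature.AlgebraicGeometry.Resolution TameFourTupleDrop

variable {k : Type} [Field k]

/-- The lift `u′♮ = insertNth i₀ 0 u′` of a successor vector `(0, u′)` vanishing on the new marked letters vanishes on the old marked letters
(`c_l = 0` on `S`, `c_{i₀} ≠ 0`). -/
theorem insertNth_apply_eq_zero_of_marked {n : ℕ} (c : Fin (n + 1) → k) (i₀ : Fin (n + 1)) (hc : c i₀ ≠ 0) (S : Finset (Fin (n + 1)))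
    (hcS : ∀ l ∈ S, c l = 0) {u' : Fin n → k}
    (huS : ∀ l ∈ S, (Fin.cons (0 : k) u' : Fin (n + 1) → k) (Fin.predAbove i₀ l.succ) = 0) :
    ∀ l ∈ S, (Fin.insertNth i₀ (0 : k) u' : Fin (n + 1) → k) l = 0 := by
  intro l hl
  have hli : l ≠ i₀ := by
    rintro rfl
    exact hc (hcS _ hl)
  obtain ⟨j, rfl⟩ := Fin.exists_succAbove_eq hli
  rw [Fin.insertNth_apply_succAbove]
  have h := huS _ hl
  rwa [predAbove_succ_succAbove_succ, Fin.cons_succ] at h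

/-- **AT A NEAR POINT WITH `e^S ≤ 2`, TWO `s`-FREE MARKED INVARIANCE VECTORS OF THE SUCCESSOR ARE DEPENDENT.** -/
theorem dep_of_inv_cons_zero_rel₂ {n : ℕ} (f : MvPowerSeries (Fin (n + 1)) k) (c : Fin (n + 1) → k) (i₀ : Fin (n + 1))
    (hc : c i₀ ≠ 0) {o : ℕ} {G : MvPowerSeries (Fin (n + 1 + 1)) k}
    (hfac : subst (CobordantChart.chart (fun _ : Fin (n + 1) => 1) c) f = X 0 ^ o * G)
    (hnear : (o : ℕ∞) ≤ (TupleGame.slice i₀ G).order) (S : Finset (Fin (n + 1))) (hcS : ∀ l ∈ S, c l = 0)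
    (htwoS : ∀ u₁ u₂ u₃ : Fin (n + 1) → k,
      (∀ v, CobordantChart.initEval (fun _ : Fin (n + 1) => 1) (v + u₁) o f = CobordantChart.initEval (fun _ : Fin (n + 1) => 1) v o f) →
      (∀ l ∈ S, u₁ l = 0) →
      (∀ v, CobordantChart.initEval (fun _ : Fin (n + 1) => 1) (v + u₂) o f = CobordantChart.initEval (fun _ : Fin (n + 1) => 1) v o f) →
      (∀ l ∈ S, u₂ l = 0) →
      (∀ v, CobordantChart.initEval (fun _ : Fin (n + 1) => 1) (v + u₃) o f = CobordantChart.initEval (fun _ : Fin (n + 1) => 1) v o f) →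
      (∀ l ∈ S, u₃ l = 0) →
      ∃ α β γ : k, (α ≠ 0 ∨ β ≠ 0 ∨ γ ≠ 0) ∧ α • u₁ + β • u₂ + γ • u₃ = 0)
    {z₁' z₂' : Fin n → k}
    (hz₁ : ∀ w, CobordantChart.initEval (fun _ : Fin (n + 1) => 1) (w + Fin.cons (0 : k) z₁') o (TupleGame.slice i₀ G) =
      CobordantChart.initEval (fun _ : Fin (n + 1) => 1) w o (TupleGame.slice i₀ G))
    (hz₁S : ∀ l ∈ S, (Fin.cons (0 : k) z₁' : Fin (n + 1) → k) (Fin.predAbove i₀ l.succ) = 0)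
    (hz₂ : ∀ w, CobordantChart.initEval (fun _ : Fin (n + 1) => 1) (w + Fin.cons (0 : k) z₂') o (TupleGame.slice i₀ G) =
      CobordantChart.initEval (fun _ : Fin (n + 1) => 1) w o (TupleGame.slice i₀ G))
    (hz₂S : ∀ l ∈ S, (Fin.cons (0 : k) z₂' : Fin (n + 1) → k) (Fin.predAbove i₀ l.succ) = 0) :
    ∃ α β : k, (α ≠ 0 ∨ β ≠ 0) ∧ α • (Fin.cons (0 : k) z₁' : Fin (n + 1) → k) + β • Fin.cons (0 : k) z₂' = 0 := by
  obtain ⟨α, β, γ, hne, hrel⟩ := htwoS _ _ c (insertNth_inv_of_inv_cons_zero f c i₀ hc hfac hnear hz₁)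
    (insertNth_apply_eq_zero_of_marked c i₀ hc S hcS hz₁S) (insertNth_inv_of_inv_cons_zero f c i₀ hc hfac hnear hz₂)
    (insertNth_apply_eq_zero_of_marked c i₀ hc S hcS hz₂S)
    (fun v => by
      have h := initEval_add_smul_eq_of_near f c i₀ hc hfac hnear 1 v
      rwa [one_smul] at h) hcS
  -- the dependence does not involve `c`
  have hi₀ := congr_fun hrel i₀
  simp only [Pi.add_apply, Pi.smul_apply, Fin.insertNth_apply_same, smul_eq_mul, mul_zero, zero_add, Pi.zero_apply] at hi₀
  have hγ : γ = 0 := (mul_eq_zero.mp hi₀).resolve_right hc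
  refine ⟨α, β, ?_, ?_⟩
  · rcases hne with h | h | h
    · exact Or.inl h
    · exact Or.inr h
    · exact absurd hγ h
  · funext l
    refine Fin.cases ?_ (fun j => ?_) l
    · simp
    · have hj := congr_fun hrel (i₀.succAbove j)
      simp only [Pi.add_apply, Pi.smul_apply, Fin.insertNth_apply_succAbove, hγ, zero_smul, add_zero, smul_eq_mul, Pi.zero_apply] at hj
      simp only [Pi.add_apply, Pi.smul_apply, Fin.cons_succ, smul_eq_mul, Pi.zero_apply]
      exact hj

/-- **(N2) AT APEX DIMENSION TWO, WITH MARKED LETTERS — `e^S ≤ 2` PERSISTS AT AN `O`-NEAR POINT**: under the point move at `c` (live slot `i₀`,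
`f(s(c + y)) = s^o · G`) with NEAR successor and `c_l = 0` on the marked letters `S`: if every three vectors of `Dir^S(in_o f)` are dependent, then
every three invariance vectors of `in_o G′` vanishing on the successor's marked letters `predAbove i₀ (succ l)`, `l ∈ S`, are dependent.
[cite: CossartJannsenSaito2020, Thm 2.10 (4) / Thm 3.23 (1) (LNM 2270)] -/
theorem apexPlaneRel_of_near {n : ℕ} (f : MvPowerSeries (Fin (n + 1)) k) (c : Fin (n + 1) → k) (i₀ : Fin (n + 1))
    (hc : c i₀ ≠ 0) {o : ℕ} {G : MvPowerSeries (Fin (n + 1 + 1)) k}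
    (hfac : subst (CobordantChart.chart (fun _ : Fin (n + 1) => 1) c) f = X 0 ^ o * G)
    (hnear : (o : ℕ∞) ≤ (TupleGame.slice i₀ G).order) (S : Finset (Fin (n + 1))) (hcS : ∀ l ∈ S, c l = 0)
    (htwoS : ∀ u₁ u₂ u₃ : Fin (n + 1) → k,
      (∀ v, CobordantChart.initEval (fun _ : Fin (n + 1) => 1) (v + u₁) o f = CobordantChart.initEval (fun _ : Fin (n + 1) => 1) v o f) →
      (∀ l ∈ S, u₁ l = 0) →
      (∀ v, CobordantChart.initEval (fun _ : Fin (n + 1) => 1) (v + u₂) o f = CobordantChart.initEval (fun _ : Fin (n + 1) => 1) v o f) →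
      (∀ l ∈ S, u₂ l = 0) →
      (∀ v, CobordantChart.initEval (fun _ : Fin (n + 1) => 1) (v + u₃) o f = CobordantChart.initEval (fun _ : Fin (n + 1) => 1) v o f) →
      (∀ l ∈ S, u₃ l = 0) →
      ∃ α β γ : k, (α ≠ 0 ∨ β ≠ 0 ∨ γ ≠ 0) ∧ α • u₁ + β • u₂ + γ • u₃ = 0)
    (w₁ w₂ w₃ : Fin (n + 1) → k)
    (hw₁ : ∀ w, CobordantChart.initEval (fun _ : Fin (n + 1) => 1) (w + w₁) o (TupleGame.slice i₀ G) =
      CobordantChart.initEval (fun _ : Fin (n + 1) => 1) w o (TupleGame.slice i₀ G))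
    (hw₁S : ∀ l ∈ S, w₁ (Fin.predAbove i₀ l.succ) = 0)
    (hw₂ : ∀ w, CobordantChart.initEval (fun _ : Fin (n + 1) => 1) (w + w₂) o (TupleGame.slice i₀ G) =
      CobordantChart.initEval (fun _ : Fin (n + 1) => 1) w o (TupleGame.slice i₀ G))
    (hw₂S : ∀ l ∈ S, w₂ (Fin.predAbove i₀ l.succ) = 0)
    (hw₃ : ∀ w, CobordantChart.initEval (fun _ : Fin (n + 1) => 1) (w + w₃) o (TupleGame.slice i₀ G) =
      CobordantChart.initEval (fun _ : Fin (n + 1) => 1) w o (TupleGame.slice i₀ G))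
    (hw₃S : ∀ l ∈ S, w₃ (Fin.predAbove i₀ l.succ) = 0) :
    ∃ α β γ : k, (α ≠ 0 ∨ β ≠ 0 ∨ γ ≠ 0) ∧ α • w₁ + β • w₂ + γ • w₃ = 0 := by
  -- an `s`-free combination of two marked invariance vectors is a marked invariance vector `(0, tail)`
  have hcomb : ∀ {x y : Fin (n + 1) → k},
      (∀ w, CobordantChart.initEval (fun _ : Fin (n + 1) => 1) (w + x) o (TupleGame.slice i₀ G) =
        CobordantChart.initEval (fun _ : Fin (n + 1) => 1) w o (TupleGame.slice i₀ G)) →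
      (∀ l ∈ S, x (Fin.predAbove i₀ l.succ) = 0) →
      (∀ w, CobordantChart.initEval (fun _ : Fin (n + 1) => 1) (w + y) o (TupleGame.slice i₀ G) =
        CobordantChart.initEval (fun _ : Fin (n + 1) => 1) w o (TupleGame.slice i₀ G)) →
      (∀ l ∈ S, y (Fin.predAbove i₀ l.succ) = 0) →
      (∀ w, CobordantChart.initEval (fun _ : Fin (n + 1) => 1) (w + Fin.cons (0 : k) (Fin.tail (x 0 • y - y 0 • x))) o (TupleGame.slice i₀ G) =
        CobordantChart.initEval (fun _ : Fin (n + 1) => 1) w o (TupleGame.slice i₀ G)) ∧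
      (∀ l ∈ S, (Fin.cons (0 : k) (Fin.tail (x 0 • y - y 0 • x)) : Fin (n + 1) → k) (Fin.predAbove i₀ l.succ) = 0) := by
    intro x y hx hxS hy hyS
    have h0 : (x 0 • y - y 0 • x) 0 = 0 := by
      show x 0 * y 0 - y 0 * x 0 = 0
      ring
    rw [← eq_cons_zero_tail h0]
    exact ⟨inv_smul_sub_smul hy hx (x 0) (y 0), fun l hl => by
      simp only [Pi.sub_apply, Pi.smul_apply, smul_eq_mul, hxS l hl, hyS l hl, mul_zero, sub_zero]⟩
  -- the pivot argument: if `x 0 ≠ 0`, eliminate the `s`-components of `y` and `z` against `x`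
  have pivot : ∀ {x y z : Fin (n + 1) → k},
      (∀ w, CobordantChart.initEval (fun _ : Fin (n + 1) => 1) (w + x) o (TupleGame.slice i₀ G) =
        CobordantChart.initEval (fun _ : Fin (n + 1) => 1) w o (TupleGame.slice i₀ G)) →
      (∀ l ∈ S, x (Fin.predAbove i₀ l.succ) = 0) →
      (∀ w, CobordantChart.initEval (fun _ : Fin (n + 1) => 1) (w + y) o (TupleGame.slice i₀ G) =
        CobordantChart.initEval (fun _ : Fin (n + 1) => 1) w o (TupleGame.slice i₀ G)) →
      (∀ l ∈ S, y (Fin.predAbove i₀ l.succ) = 0) →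
      (∀ w, CobordantChart.initEval (fun _ : Fin (n + 1) => 1) (w + z) o (TupleGame.slice i₀ G) =
        CobordantChart.initEval (fun _ : Fin (n + 1) => 1) w o (TupleGame.slice i₀ G)) →
      (∀ l ∈ S, z (Fin.predAbove i₀ l.succ) = 0) →
      x 0 ≠ 0 → ∃ α β γ : k, (α ≠ 0 ∨ β ≠ 0 ∨ γ ≠ 0) ∧ α • x + β • y + γ • z = 0 := by
    intro x y z hx hxS hy hyS hz hzS hx0
    obtain ⟨hp, hpS⟩ := hcomb hx hxS hy hyS
    obtain ⟨hq, hqS⟩ := hcomb hx hxS hz hzS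
    obtain ⟨α, β, hαβ, hrel⟩ := dep_of_inv_cons_zero_rel₂ f c i₀ hc hfac hnear S hcS htwoS hp hpS hq hqS
    have hp0 : (x 0 • y - y 0 • x) 0 = 0 := by
      show x 0 * y 0 - y 0 * x 0 = 0
      ring
    have hq0 : (x 0 • z - z 0 • x) 0 = 0 := by
      show x 0 * z 0 - z 0 * x 0 = 0
      ring
    rw [← eq_cons_zero_tail hp0, ← eq_cons_zero_tail hq0] at hrel
    -- `α (x₀ y − y₀ x) + β (x₀ z − z₀ x) = 0`
    refine ⟨-(α * y 0) - β * z 0, α * x 0, β * x 0, ?_, ?_⟩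
    · rcases hαβ with h | h
      · exact Or.inr (Or.inl (mul_ne_zero h hx0))
      · exact Or.inr (Or.inr (mul_ne_zero h hx0))
    · funext l
      have hl := congr_fun hrel l
      simp only [Pi.add_apply, Pi.sub_apply, Pi.smul_apply, smul_eq_mul, Pi.zero_apply] at hl ⊢
      linear_combination hl
  by_cases h1 : w₁ 0 = 0
  · by_cases h2 : w₂ 0 = 0
    · -- `w₁`, `w₂` are both `s`-free
      have hw₁' := hw₁
      have hw₁S' := hw₁S
      have hw₂' := hw₂
      have hw₂S' := hw₂S
      rw [eq_cons_zero_tail h1] at hw₁' hw₁S'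
      rw [eq_cons_zero_tail h2] at hw₂' hw₂S'
      obtain ⟨α, β, hαβ, hrel⟩ := dep_of_inv_cons_zero_rel₂ f c i₀ hc hfac hnear S hcS htwoS hw₁' hw₁S' hw₂' hw₂S'
      rw [← eq_cons_zero_tail h1, ← eq_cons_zero_tail h2] at hrel
      refine ⟨α, β, 0, ?_, by rw [zero_smul, add_zero, hrel]⟩
      rcases hαβ with h | h
      · exact Or.inl h
      · exact Or.inr (Or.inl h)
    · obtain ⟨α, β, γ, hne, hrel⟩ := pivot hw₂ hw₂S hw₁ hw₁S hw₃ hw₃S h2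
      refine ⟨β, α, γ, ?_, by rw [← hrel]; abel⟩
      rcases hne with h | h | h
      · exact Or.inr (Or.inl h)
      · exact Or.inl h
      · exact Or.inr (Or.inr h)
  · exact pivot hw₁ hw₁S hw₂ hw₂S hw₃ hw₃S h1

/-- **(N2) AT APEX DIMENSION TWO, UNMARKED**: if every three invariance vectors of `in_o f` are dependent, then at a near point every three
invariance vectors of `in_o G′` are dependent — the engine's binder `htwo` propagated to the successor of a near point move. -/
theorem apexPlane_of_near {n : ℕ} (f : MvPowerSeries (Fin (n + 1)) k) (c : Fin (n + 1) → k) (i₀ : Fin (n + 1))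
    (hc : c i₀ ≠ 0) {o : ℕ} {G : MvPowerSeries (Fin (n + 1 + 1)) k}
    (hfac : subst (CobordantChart.chart (fun _ : Fin (n + 1) => 1) c) f = X 0 ^ o * G)
    (hnear : (o : ℕ∞) ≤ (TupleGame.slice i₀ G).order)
    (htwo : ∀ u₁ u₂ u₃ : Fin (n + 1) → k,
      (∀ v, CobordantChart.initEval (fun _ : Fin (n + 1) => 1) (v + u₁) o f = CobordantChart.initEval (fun _ : Fin (n + 1) => 1) v o f) →
      (∀ v, CobordantChart.initEval (fun _ : Fin (n + 1) => 1) (v + u₂) o f = CobordantChart.initEval (fun _ : Fin (n + 1) => 1) v o f) →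
      (∀ v, CobordantChart.initEval (fun _ : Fin (n + 1) => 1) (v + u₃) o f = CobordantChart.initEval (fun _ : Fin (n + 1) => 1) v o f) →
      ∃ α β γ : k, (α ≠ 0 ∨ β ≠ 0 ∨ γ ≠ 0) ∧ α • u₁ + β • u₂ + γ • u₃ = 0)
    (w₁ w₂ w₃ : Fin (n + 1) → k)
    (hw₁ : ∀ w, CobordantChart.initEval (fun _ : Fin (n + 1) => 1) (w + w₁) o (TupleGame.slice i₀ G) =
      CobordantChart.initEval (fun _ : Fin (n + 1) => 1) w o (TupleGame.slice i₀ G))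
    (hw₂ : ∀ w, CobordantChart.initEval (fun _ : Fin (n + 1) => 1) (w + w₂) o (TupleGame.slice i₀ G) =
      CobordantChart.initEval (fun _ : Fin (n + 1) => 1) w o (TupleGame.slice i₀ G))
    (hw₃ : ∀ w, CobordantChart.initEval (fun _ : Fin (n + 1) => 1) (w + w₃) o (TupleGame.slice i₀ G) =
      CobordantChart.initEval (fun _ : Fin (n + 1) => 1) w o (TupleGame.slice i₀ G)) :
    ∃ α β γ : k, (α ≠ 0 ∨ β ≠ 0 ∨ γ ≠ 0) ∧ α • w₁ + β • w₂ + γ • w₃ = 0 :=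
  apexPlaneRel_of_near f c i₀ hc hfac hnear ∅ (fun _ h => absurd h (Finset.notMem_empty _))
    (fun u₁ u₂ u₃ h₁ _ h₂ _ h₃ _ => htwo u₁ u₂ u₃ h₁ h₂ h₃) w₁ w₂ w₃ hw₁ (fun _ h => absurd h (Finset.notMem_empty _)) hw₂
    (fun _ h => absurd h (Finset.notMem_empty _)) hw₃ (fun _ h => absurd h (Finset.notMem_empty _))

end TOT2Near

end Summit.ResolutionOfSingularities.ResolutionOfSingularities.Theorems

end
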